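import Summits.MatrixMultiplication.MatrixMultiplication.Theorems.MatrixPointInterpolationInterpolationLemma

/-!
# `MatrixPointInterpolation.FewPointMasquerades` — strength certificate (crux ≥ summit)

Route `MatrixMultiplication/MatrixPointInterpolation`, deciding crux `FewPointMasquerades`
(stmt-MatrixMultiplication-18199).  The route's deciding theorem is
`closes (hF : FewPointMasquerades) (hI : InterpolationLemma) : MatrixMultiplication`, and its only
other hypothesis `InterpolationLemma` (stmt-MatrixMultiplication-18941) is PROVED in the tree
(`interpolationLemma_proof`).  Hence the crux ALONE implies the summit: it is a certified
strengthening of `ω(ℂ) = 2` (tribunal T1(d) datum).  This file records that as citable theorems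
whose conclusions are stated on `omega ℂ` (the summit's definiens, `MatrixMultiplication_iff`):

* `omega_le_two_add_of_fewPointFamily` — LADDER CALIBRATION: a few-point family at ONE fixed
  accuracy `ε > 0` and ONE point size `k` (the `∀ n₀ ∃ …` body of the crux) already gives
  `ω(ℂ) ≤ 2 + ε`.  So a rung of the crux at any `ε < 0.3714` would be a new upper bound on `ω`
  (record `ω < 2.371339`, arXiv:2404.16349), while the only rungs known (corner/shift pairs, which
  need `N k³ ≥ n³` points by the slot-rank lemma, `Cruxes/FewPointMasquerades/Ideas/slot-rank.md`)
  sit at `ε = 1`, inside the trivial regime `ω ≤ 3`;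
* `omega_eq_two_of_fewPointMasquerades : FewPointMasquerades → omega ℂ = 2` and
  `matrixMultiplication_of_fewPointMasquerades : FewPointMasquerades → MatrixMultiplication` — the
  crux alone gives the summit (`closes` ∘ `interpolationLemma_proof`; converse unknown);
* (the route's rev-2 `Assembly` item, `FewPointMasquerades → InterpolationLemma →
  MatrixMultiplication`, stmt-MatrixMultiplication-18225, is `closes` verbatim and is the type of the
  landed name `matrixPointInterpolation_assembly_proof`, whose file still carries the rev-1 proof and
  awaits the one-line migration recorded in the route header; it is deliberately not restated here.)

No unproved named fact is assumed (cone: `interpolationLemma_proof`, `tensorRank_matMulTensor_le`,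
`omega_le_logb_of_rank_le'` with the discharged `Blaser2013Thm59_holds`,
`matMulTensor_sq_le_tensorRank`, `omega_two_le`, `MatrixMultiplication_iff`).

References: P. Bürgisser, M. Clausen, M. A. Shokrollahi, *Algebraic Complexity Theory* (1997),
Prop. 18.22; M. Bläser, *Fast Matrix Multiplication* (2013), Thm. 5.9.
-/

-- single-conjunct summit (D-0017): mandated namespace repeats `MatrixMultiplication`.
set_option linter.dupNamespace false

namespace Summit.MatrixMultiplication.MatrixMultiplication.Theorems

open Literature.Computability.AlgebraicComplexity
open Summit.MatrixMultiplication.MatrixMultiplication.Theses.MatrixPointInterpolation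

/-- **Ladder calibration** (fixed accuracy): if for ONE `ε > 0` and ONE point size `k` there are,
beyond every `n₀`, a size `n ≥ n₀`, a degree `d`, a pair `A ∈ M_n(ℂ)²` generating `M_n` in degree
`d` and `N ≤ n^(2+ε)` points `B t ∈ M_k(ℂ)²` through which evaluation on the window `2d` factorises,
then `ω(ℂ) ≤ 2 + ε`.  Proof: for `η > 0` take `n ≥ 2` with `k³ ≤ n^(η/2)`; the interpolation lemma
(`interpolationLemma_proof`, BCS 1997 Prop. 18.22) gives `R(⟨n,n,n⟩) ≤ N·R(⟨k,k,k⟩) ≤ N k³ ≤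
n^(2+ε+η/2)`, and Bläser's single-format bound `ω ≤ log_n R(⟨n,n,n⟩)` gives
`ω ≤ 2 + ε + η/2 < 2 + ε + η`. [cite: Blaser2013, Thm. 5.9] -/
theorem omega_le_two_add_of_fewPointFamily {ε : ℝ} {k : ℕ}
    (hfam : ∀ n₀ : ℕ, ∃ (n d N : ℕ) (A : Fin 2 → Matrix (Fin n) (Fin n) ℂ)
      (B : Fin N → Fin 2 → Matrix (Fin k) (Fin k) ℂ), n₀ ≤ n ∧
      (N : ℝ) ≤ (n : ℝ) ^ ((2 : ℝ) + ε) ∧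
      Submodule.span ℂ {M : Matrix (Fin n) (Fin n) ℂ |
        ∃ w : List (Fin 2), w.length ≤ d ∧ (w.map A).prod = M} = ⊤ ∧
      ∀ (T : Finset (List (Fin 2))) (c : List (Fin 2) → ℂ), (∀ w ∈ T, w.length ≤ 2 * d) →
        (∀ t : Fin N, (∑ w ∈ T, c w • (w.map (B t)).prod) = 0) →
        (∑ w ∈ T, c w • (w.map A).prod) = 0) :
    omega ℂ ≤ 2 + ε := by
  refine le_of_forall_pos_lt_add fun η hη => ?_
  have hη2 : (0 : ℝ) < η / 2 := by linarith
  have hkpos : (0 : ℝ) ≤ (k : ℝ) ^ 3 := by positivity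
  obtain ⟨n₂, hn₂⟩ : ∃ n₂ : ℕ, ∀ n : ℕ, n₂ ≤ n → ((k ^ 3 : ℕ) : ℝ) ≤ (n : ℝ) ^ (η / 2) := by
    refine ⟨⌈((k : ℝ) ^ 3) ^ (1 / (η / 2))⌉₊ + 1, fun n hn => ?_⟩
    have h1 : ((k : ℝ) ^ 3) ^ (1 / (η / 2)) ≤ n := by
      have : ((k : ℝ) ^ 3) ^ (1 / (η / 2)) ≤ (⌈((k : ℝ) ^ 3) ^ (1 / (η / 2))⌉₊ + 1 : ℕ) := by
        push_cast
        exact (Nat.le_ceil _).trans (by linarith)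
      exact this.trans (by exact_mod_cast hn)
    have h2 : (((k : ℝ) ^ 3) ^ (1 / (η / 2))) ^ (η / 2) ≤ (n : ℝ) ^ (η / 2) :=
      Real.rpow_le_rpow (Real.rpow_nonneg hkpos _) h1 hη2.le
    have h3 : (((k : ℝ) ^ 3) ^ (1 / (η / 2))) ^ (η / 2) = (k : ℝ) ^ 3 := by
      rw [← Real.rpow_mul hkpos, one_div_mul_cancel hη2.ne', Real.rpow_one]
    rw [h3] at h2
    exact_mod_cast h2
  obtain ⟨n, d, N, A, B, hn0, hN, hspan, hB⟩ := hfam (max n₂ 2)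
  have hn2' : n₂ ≤ n := le_trans (le_max_left _ _) hn0
  have hn : 2 ≤ n := le_trans (le_max_right _ _) hn0
  have hR : tensorRank (matMulTensor ℂ n n n) ≤ N * tensorRank (matMulTensor ℂ k k k) :=
    interpolationLemma_proof n k 2 d N A B hspan hB
  have hr : tensorRank (matMulTensor ℂ n n n) ≤ N * k ^ 3 := by
    refine hR.trans (Nat.mul_le_mul_left N ?_)
    have := tensorRank_matMulTensor_le ℂ k k k
    simpa [pow_succ, mul_assoc] using this
  have hnpos : (0 : ℝ) < n := by exact_mod_cast (lt_of_lt_of_le (by norm_num) hn)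
  have hcost : ((N * k ^ 3 : ℕ) : ℝ) ≤ (n : ℝ) ^ ((2 : ℝ) + ε + η / 2) := by
    have hk3 : ((k ^ 3 : ℕ) : ℝ) ≤ (n : ℝ) ^ (η / 2) := hn₂ n hn2'
    have h0 : (0 : ℝ) ≤ (n : ℝ) ^ ((2 : ℝ) + ε) := Real.rpow_nonneg hnpos.le _
    calc ((N * k ^ 3 : ℕ) : ℝ) = (N : ℝ) * ((k ^ 3 : ℕ) : ℝ) := by push_cast; ring
      _ ≤ (n : ℝ) ^ ((2 : ℝ) + ε) * (n : ℝ) ^ (η / 2) :=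
          mul_le_mul hN hk3 (by positivity) h0
      _ = (n : ℝ) ^ ((2 : ℝ) + ε + η / 2) := by
          rw [← Real.rpow_add hnpos]
  have hω : omega ℂ ≤ Real.logb n ((N * k ^ 3 : ℕ) : ℝ) := by
    have := omega_le_logb_of_rank_le' Blaser2013Thm59_holds ℂ hn hr
    exact_mod_cast this
  have hpos : (0 : ℝ) < ((N * k ^ 3 : ℕ) : ℝ) := by
    have h0 := matMulTensor_sq_le_tensorRank ℂ n
    have h4 : 4 ≤ n ^ 2 := by nlinarith
    have h44 : 4 ≤ N * k ^ 3 := h4.trans (h0.trans hr)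
    exact_mod_cast lt_of_lt_of_le (by norm_num : (0 : ℕ) < 4) h44
  have hn1r : (1 : ℝ) < n := by exact_mod_cast (lt_of_lt_of_le one_lt_two hn)
  have hlog : Real.logb n ((N * k ^ 3 : ℕ) : ℝ) ≤ 2 + ε + η / 2 := by
    calc Real.logb n ((N * k ^ 3 : ℕ) : ℝ)
        ≤ Real.logb n ((n : ℝ) ^ ((2 : ℝ) + ε + η / 2)) :=
          Real.logb_le_logb_of_le hn1r hpos hcost
      _ = 2 + ε + η / 2 := Real.logb_rpow (by linarith) hn1r.ne'
  linarith

/-- The crux re-derives `ω(ℂ) ≤ 2` rung by rung: at accuracy `ε/2` it supplies a point size `k`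
and a few-point family, and the calibration gives `ω ≤ 2 + ε/2 < 2 + ε`. [folklore] -/
theorem omega_le_two_of_fewPointMasquerades (h : FewPointMasquerades) : omega ℂ ≤ 2 := by
  refine le_of_forall_pos_lt_add fun ε hε => ?_
  obtain ⟨k, hk⟩ := h (ε / 2) (by linarith)
  have := omega_le_two_add_of_fewPointFamily (ε := ε / 2) (k := k) hk
  linarith

/-- **Strength certificate** (T1(d) datum for stmt-MatrixMultiplication-18199): the crux
`FewPointMasquerades` alone gives `ω(ℂ) = 2`, i.e. the summit (`MatrixMultiplication_iff`); the
lower bound is the flattening theorem `omega_two_le`. [folklore] -/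
theorem omega_eq_two_of_fewPointMasquerades (h : FewPointMasquerades) : omega ℂ = 2 :=
  le_antisymm (omega_le_two_of_fewPointMasquerades h) (omega_two_le ℂ)

/-- **Strength certificate, summit form** (T1(d) datum for stmt-MatrixMultiplication-18199; the
shape of `matrixMultiplication_of_ShapeSubmodular` in `ShapeSubmodularityShapeSubmodularSummitEquivalence`):
the crux `FewPointMasquerades` ALONE implies the summit statement `MatrixMultiplication` — the
route's deciding theorem `closes` with its second hypothesis `InterpolationLemma` discharged by the
landed `interpolationLemma_proof`.  The converse `MatrixMultiplication → FewPointMasquerades` is NOT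
known (the crux is a certified strengthening, believed strict: `ω(ℂ) = 2` yields two-letter
few-point shadows only through an alphabet compression whose point size grows like `n²`, see
`Cruxes/FewPointMasquerades/STRATEGY-CENSUS.md`). [cite: BurgisserClausenShokrollahi1997, Prop. 18.22] -/
theorem matrixMultiplication_of_fewPointMasquerades (h : FewPointMasquerades) :
    _root_.MatrixMultiplication :=
  closes h interpolationLemma_proof

/-- The two strength forms agree (`MatrixMultiplication ↔ ω(ℂ) = 2` is `MatrixMultiplication_iff`).
[folklore] -/
theorem matrixMultiplication_of_fewPointMasquerades' (h : FewPointMasquerades) :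
    _root_.MatrixMultiplication :=
  (_root_.MatrixMultiplication_iff).2 (omega_eq_two_of_fewPointMasquerades h)

end Summit.MatrixMultiplication.MatrixMultiplication.Theorems
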